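import Mathlib.Analysis.MeanInequalities
import Mathlib.Analysis.SpecialFunctions.Pow.Real
import Literature.NumberTheory.Sieve.AsymptoticSieveForPrimesInputs
import Literature.NumberTheory.Sieve.AsymptoticSieveForPrimesProofs
import Literature.NumberTheory.Sieve.SmallDivisorLemma
import Literature.NumberTheory.LFunctions.MertensElementary
import HarnessLib

/-!
# Asymptotic sieve for primes: the reductions (R) ⟹ (R′) and (B) ⟹ (B′) (proofs)

Trunk T-SIEVE. Source: J. Friedlander, H. Iwaniec, *Asymptotic sieve for primes*, Ann. of Math. 148
(1998) 1041–1065 [FriedlanderIwaniecASP1998] (= arXiv:math/9811186), §2 "Technical reductions",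
pp. 1046–1047: (R′), Lemma 1, (2.1)–(2.3), "Finally (R′) follows from (R) and (2.3) by Hölder's
inequality."

This file DISCHARGES the named facts `Literature.NumberTheory.Sieve.fi_reduced_remainder_bound` (FI (R′)) and
`Literature.NumberTheory.Sieve.fi_reduced_bilinear_bound` (FI (B′): "The derivation of (B′) from (B) is similar")
(`Literature.NumberTheory.Sieve.AsymptoticSieveForPrimesInputs`) from the tree:
FI Lemma 1 (`Literature.NumberTheory.Sieve.Squarefree.exists_dvd_pow_le_card_divisors_le`, `SmallDivisorLemma`), Mertens'
bound `∑_{p ≤ N} 1/p ≤ log log N + 4` (`Literature.NumberTheory.LFunctions.MertensBound.sum_inv_prime_le`, `MertensElementary`),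
the monotonicity of `A_d(x)` (`AsymptoticSieveForPrimesProofs`) and Mathlib's Hölder inequality
(`Real.inner_le_Lp_mul_Lq_of_nonneg`). Everything here is a theorem.

## The argument (FI p. 1047, with explicit constants)

For large `x`, `t ≤ x`, `S = {d ≤ D(x) : d squarefree}`, `L = log x ≥ 1`, `A = A(x)`:
* `|r_d(t)| ≤ A_d(x) + g(d) A(x)` (`a_n ≥ 0`, `t ≤ x`, `g(d) ≥ 0`);
* (2.1) with the weight `9^{ω(d)} ≥ τ₅(d)^{4/3}`: `∑_S 9^{ω(d)} A_d(x) ≤ ∑_{n ≤ x} a_n 10^{ω(n)}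
  ≤ ∑ a_n τ(n)^4 ≤ ∑_{d ≤ x^{1/3}, d sqfree} (2τ(d))^{12} A_d(x) ≤ 2^{12} K₆ A ∑ τ(d)^{20}/d
  ≤ 2^{12} K₆ e^{2^{22}} A L^{2^{20}}` (Lemma 1 with `k = 3`, (1.6), and
  `V(N) = ∑_{d ≤ N sqfree} τ(d)^{20}/d ≤ ∏_{p ≤ N}(1 + 2^{20}/p) ≤ exp(2^{20}(log log N + 4))`);
* (2.2): `∑_{d ≤ x sqfree} 9^{ω(d)} g(d) ≤ ∏_{p ≤ x}(1 + 9g(p)) ≤ exp(9 ∑_{p ≤ x} g(p)) ≤ e^{9C} L^9`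
  by (1.9), `C = |c| + |K₉|/(log 2)^{10}`;
* hence `R₁ = ∑_S 9^{ω(d)}|r_d(t)| ≤ C₁ A L^{2^{20}}`, and (R) gives `R₀ = ∑_S |r_d(t)| ≤ A L^{-2^{22}}`;
* Hölder (`4`, `4/3`) with `τ₅(d) = 5^{ω(d)}`, `5^{4/3} ≤ 9`:
  `∑_S τ₅(d)|r_d(t)| ≤ R₀^{1/4} R₁^{3/4} ≤ C₁^{3/4} A L^{-2^{18}} ≤ (C₁ + 1) A / L³`.
* (B′): with `I_m` the inner sum of the bilinear form and `M = {1 ≤ m ≤ x}`, (B) gives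
  `∑_M |I_m| ≤ A L^{-2^{22}}`; only squarefree `m` contribute by (1.16); `|γ(n, C)| ≤ τ(n)` and the
  rearrangement `∑_m ∑_n ≤ ∑_{k ≤ x} ∑_{mn = k}` (`sum_sum_le_sum_divisorsAntidiagonal`) give
  `∑_{m sqfree} 9^{ω(m)}|I_m| ≤ ∑_k a_k ∑_{mn=k} 9^{ω(m)}τ(n) = ∑ a_k 11^{ω(k)} ≤ ∑ a_k τ(k)^4
  ≤ C₁ A L^{2^{20}}` (`sum_a_mul_card_divisors_pow_four_le`); then the same Hölder tail
  (`holder_tail_le`).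

## Mathlib search

Used: `Finset.prod_one_add`, `Nat.prod_primeFactors_of_squarefree`, `Real.add_one_le_exp`,
`Real.inner_le_Lp_mul_Lq_of_nonneg`, `Real.holderConjugate_iff`, `Real.rpow_*`. The tree's
`divisorCountK_apply_of_squarefree`, `divisorCountK_succ_apply`, `divisorCountK_two`
(`AsymptoticSieveForPrimesInputs`) give `τ_k(n) = k^{ω(n)}`, `∑_{d ∣ n} 9^{ω(d)} = 10^{ω(n)}` and
`τ(d) = 2^{ω(d)}` on squarefree integers.
-/

noncomputable section

open Filter Finset
open scoped ArithmeticFunction.Moebius ArithmeticFunction.sigma ArithmeticFunction.omega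

namespace Literature.NumberTheory.Sieve

/-! ### Sums of multiplicative functions over squarefree integers -/

/-- `∑_{d ≤ N, d squarefree} ∏_{p ∣ d} f(p) ≤ ∏_{p ≤ N} (1 + f(p))` for `f ≥ 0` on primes: expand
the product over subsets of the primes `≤ N` and note that `d ↦ primeFactors d` is injective on
squarefree `d`. [folklore] -/
theorem sum_squarefree_prod_primeFactors_le {f : ℕ → ℝ} (hf : ∀ p : ℕ, p.Prime → 0 ≤ f p) (N : ℕ) :
    ∑ d ∈ (Icc 1 N).filter Squarefree, ∏ p ∈ d.primeFactors, f p ≤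
      ∏ p ∈ Nat.primesLE N, (1 + f p) := by
  classical
  rw [Finset.prod_one_add]
  set S := (Icc 1 N).filter Squarefree with hS
  have hinj : Set.InjOn Nat.primeFactors (S : Set ℕ) := by
    intro d hd e he hde
    have hd' := (Finset.mem_filter.mp (Finset.mem_coe.mp hd)).2
    have he' := (Finset.mem_filter.mp (Finset.mem_coe.mp he)).2
    rw [← Nat.prod_primeFactors_of_squarefree hd', ← Nat.prod_primeFactors_of_squarefree he', hde]
  rw [← Finset.sum_image (f := fun T : Finset ℕ => ∏ p ∈ T, f p) hinj]
  refine Finset.sum_le_sum_of_subset_of_nonneg (fun T hT => ?_) (fun T hT _ => ?_)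
  · obtain ⟨d, hd, rfl⟩ := Finset.mem_image.mp hT
    obtain ⟨hd1, hd2⟩ := Finset.mem_filter.mp hd
    refine Finset.mem_powerset.mpr fun p hp => ?_
    have hpd := Nat.le_of_mem_primeFactors hp
    exact Nat.mem_primesLE.mpr ⟨hpd.trans (Finset.mem_Icc.mp hd1).2, Nat.prime_of_mem_primeFactors hp⟩
  · exact Finset.prod_nonneg fun p hp =>
      hf p (Nat.prime_of_mem_primesLE (Finset.mem_powerset.mp hT hp))

/-- `∏_{i ∈ s} (1 + f i) ≤ exp(∑_{i ∈ s} f i)` for `f ≥ 0`. [folklore] -/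
theorem prod_one_add_le_exp_sum {ι : Type*} (s : Finset ι) {f : ι → ℝ} (hf : ∀ i ∈ s, 0 ≤ f i) :
    ∏ i ∈ s, (1 + f i) ≤ Real.exp (∑ i ∈ s, f i) := by
  rw [Real.exp_sum]
  refine Finset.prod_le_prod (fun i hi => by linarith [hf i hi]) fun i _ => ?_
  linarith [Real.add_one_le_exp (f i)]

/-- For squarefree `d`, `τ(d) = 2^{ω(d)}` (`ω(d) = #primeFactors d`). [folklore] -/
theorem card_divisors_of_squarefree {d : ℕ} (hd : Squarefree d) :
    d.divisors.card = 2 ^ d.primeFactors.card := by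
  have h := congrArg (fun f : ArithmeticFunction ℕ => f d) divisorCountK_two
  simp only [ArithmeticFunction.sigma_zero_apply] at h
  rw [← h, divisorCountK_apply_of_squarefree 2 hd, card_primeFactors_eq_cardDistinctFactors]

/-- For squarefree `d`, `τ(d)^{20}/d = ∏_{p ∣ d} 2^{20}/p`. [folklore] -/
theorem card_divisors_pow_div_eq_prod {d : ℕ} (hd : Squarefree d) :
    ((d.divisors.card : ℝ) ^ 20) / d = ∏ p ∈ d.primeFactors, (2 : ℝ) ^ 20 / p := by
  rw [card_divisors_of_squarefree hd, Finset.prod_div_distrib, Finset.prod_const,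
    ← Nat.cast_prod, Nat.prod_primeFactors_of_squarefree hd]
  push_cast
  rw [← pow_mul, mul_comm, pow_mul]

/-- `V(N) = ∑_{d ≤ N, d squarefree} τ(d)^{20}/d ≤ exp(2^{20}(log log N + 4))` for `N ≥ 2` (FI p. 1047:
"`V(x) ≪ (log x)^{2^{20}}`"), by `sum_squarefree_prod_primeFactors_le` and Mertens' bound
`∑_{p ≤ N} 1/p ≤ log log N + 4` (`Literature.NumberTheory.LFunctions.MertensBound.sum_inv_prime_le`).
[cite: FriedlanderIwaniecASP1998, §2 (2.1)] -/
theorem sum_squarefree_card_divisors_pow_div_le (N : ℕ) (hN : 2 ≤ N) :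
    ∑ d ∈ (Icc 1 N).filter Squarefree, ((d.divisors.card : ℝ) ^ 20) / d ≤
      Real.exp (2 ^ 20 * (Real.log (Real.log N) + 4)) := by
  have h1 : ∑ d ∈ (Icc 1 N).filter Squarefree, ((d.divisors.card : ℝ) ^ 20) / d =
      ∑ d ∈ (Icc 1 N).filter Squarefree, ∏ p ∈ d.primeFactors, (2 : ℝ) ^ 20 / p :=
    Finset.sum_congr rfl fun d hd => card_divisors_pow_div_eq_prod (Finset.mem_filter.mp hd).2
  rw [h1]
  refine (sum_squarefree_prod_primeFactors_le (fun p _ => by positivity) N).trans ?_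
  refine (prod_one_add_le_exp_sum _ fun p _ => by positivity).trans ?_
  refine Real.exp_le_exp.mpr ?_
  simp_rw [div_eq_mul_inv]
  rw [← Finset.mul_sum]
  refine mul_le_mul_of_nonneg_left ?_ (by positivity)
  have := LFunctions.MertensBound.sum_inv_prime_le N hN
  simpa [one_div] using this

/-! ### Swapping `d` and `n` -/

namespace SieveSequence

/-- `∑_{d ∈ T} F(d) A_d(x) = ∑_{n ≤ x} a_n ∑_{d ∈ T, d ∣ n} F(d)`. [folklore] -/
theorem sum_mul_congrSum_eq (A : SieveSequence) (T : Finset ℕ) (F : ℕ → ℝ) (x : ℝ) :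
    ∑ d ∈ T, F d * A.congrSum d x =
      ∑ n ∈ Ioc 0 ⌊x⌋₊, A.a n * ∑ d ∈ T.filter (· ∣ n), F d := by
  classical
  simp only [congrSum, Finset.mul_sum, Finset.sum_filter]
  rw [Finset.sum_comm]
  refine Finset.sum_congr rfl fun n _ => Finset.sum_congr rfl fun d _ => ?_
  split_ifs <;> ring

/-! ### Divisor-function inequalities on squarefree integers -/

/-- `∑_{d ∣ n} 9^{ω(d)} = 10^{ω(n)}` for squarefree `n` (`τ₁₀ = τ₉ * 1`). [folklore] -/
theorem sum_divisors_nine_pow_of_squarefree {n : ℕ} (hn : Squarefree n) :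
    ∑ d ∈ n.divisors, (9 : ℝ) ^ d.primeFactors.card = (10 : ℝ) ^ n.primeFactors.card := by
  have h := divisorCountK_succ_apply 9 n
  rw [divisorCountK_apply_of_squarefree 10 hn] at h
  have h' : ((10 ^ ω n : ℕ) : ℝ) = ∑ d ∈ n.divisors, ((divisorCountK 9 d : ℕ) : ℝ) := by
    rw [h]; push_cast; rfl
  rw [← card_primeFactors_eq_cardDistinctFactors] at h'
  push_cast at h'
  rw [h']
  refine Finset.sum_congr rfl fun d hd => ?_
  rw [divisorCountK_apply_of_squarefree 9 (hn.squarefree_of_dvd (Nat.dvd_of_mem_divisors hd)),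
    ← card_primeFactors_eq_cardDistinctFactors]
  push_cast
  rfl

/-- `10^{ω(n)} ≤ τ(n)^4` for squarefree `n` (`τ(n) = 2^{ω(n)}`, `10 ≤ 16`). [folklore] -/
theorem ten_pow_le_card_divisors_pow_four {n : ℕ} (hn : Squarefree n) :
    (10 : ℝ) ^ n.primeFactors.card ≤ ((n.divisors.card : ℝ)) ^ 4 := by
  rw [card_divisors_of_squarefree hn]
  push_cast
  rw [← pow_mul, mul_comm, pow_mul]
  norm_num
  exact pow_le_pow_left₀ (by norm_num) (by norm_num) _

/-- FI Lemma 1 with `k = 3` in the form used for (2.1): for squarefree `n`,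
`τ(n)^4 ≤ ∑_{d ∣ n, d³ ≤ n} (2τ(d))^{12}`. [cite: FriedlanderIwaniecASP1998, §2 Lemma 1] -/
theorem card_divisors_pow_four_le_sum {n : ℕ} (hn : Squarefree n) :
    ((n.divisors.card : ℝ)) ^ 4 ≤
      ∑ d ∈ n.divisors.filter (fun d => d ^ 3 ≤ n), (2 * (d.divisors.card : ℝ)) ^ 12 := by
  obtain ⟨d, hdn, hd3, hτ⟩ := Squarefree.exists_dvd_pow_le_card_divisors_le (k := 3) (by norm_num) hn
  have hd : d ∈ n.divisors.filter (fun d => d ^ 3 ≤ n) :=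
    Finset.mem_filter.mpr ⟨Nat.mem_divisors.mpr ⟨hdn, hn.ne_zero⟩, hd3⟩
  refine le_trans ?_ (Finset.single_le_sum (fun e _ => by positivity) hd)
  have h' : ((n.divisors.card : ℝ)) ≤ (2 * (d.divisors.card : ℝ)) ^ 3 := by exact_mod_cast hτ
  calc ((n.divisors.card : ℝ)) ^ 4 ≤ ((2 * (d.divisors.card : ℝ)) ^ 3) ^ 4 :=
        pow_le_pow_left₀ (Nat.cast_nonneg _) h' 4
    _ = (2 * (d.divisors.card : ℝ)) ^ 12 := by rw [← pow_mul]

variable {A : SieveSequence} {D δ Δ : ℝ → ℝ}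

/-- `|r_d(t)| ≤ A_d(x) + g(d) A(x)` for `t ≤ x` and `g(d) ≥ 0` (FI p. 1047: "we replace `|r_d(t)|`
by `A_d(x) + g(d)A(x)`", cf. §9). [cite: FriedlanderIwaniecASP1998, §2 (2.3)] -/
theorem FIAsymptoticSieveHypotheses.abs_remainder_le (h : A.FIAsymptoticSieveHypotheses D δ Δ)
    {d : ℕ} (hg : 0 ≤ A.density d) {t x : ℝ} (htx : t ≤ x) :
    |A.remainder d t| ≤ A.congrSum d x + A.density d * A.size x := by
  rw [h.remainder_eq, h.size_eq]
  have h1 : 0 ≤ A.congrSum d t := A.congrSum_nonneg d t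
  have h2 : A.congrSum d t ≤ A.congrSum d x := A.congrSum_mono d htx
  have h3 : 0 ≤ A.density d * A.congrSum 1 t := mul_nonneg hg (A.congrSum_nonneg 1 t)
  have h4 : A.density d * A.congrSum 1 t ≤ A.density d * A.congrSum 1 x :=
    mul_le_mul_of_nonneg_left (A.congrSum_mono 1 htx) hg
  rw [abs_le]
  constructor <;> linarith

/-- The density is nonnegative on squarefree integers (multiplicativity and (1.8)). [folklore] -/
theorem FIAsymptoticSieveHypotheses.density_nonneg_of_squarefree
    (h : A.FIAsymptoticSieveHypotheses D δ Δ) {d : ℕ} (hd : Squarefree d) : 0 ≤ A.density d := by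
  rw [← A.density_mult.prod_primeFactors hd]
  exact Finset.prod_nonneg fun p hp => (h.density_prime (Nat.prime_of_mem_primeFactors hp)).1

/-- **(2.1), core.** `∑_{n ≤ x} a_n τ(n)^4 ≤ ∑_{d ≤ x^{1/3}, d sqfree} (2τ(d))^{12} A_d(x)
≤ 2^{12} K₆ e^{2^{22}} A(x) (log x)^{2^{20}}` (FI p. 1047, by Lemma 1 with `k = 3`, (1.6) and
`V(x) ≪ (log x)^{2^{20}}`), given (1.6) at `x ≥ 8` with constant `K₆`.
[cite: FriedlanderIwaniecASP1998, §2 (2.1)] -/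
theorem FIAsymptoticSieveHypotheses.sum_a_mul_card_divisors_pow_four_le
    (h : A.FIAsymptoticSieveHypotheses D δ Δ) {K₆ x : ℝ} (hx : 8 ≤ x)
    (h16 : ∀ d : ℕ, 1 ≤ d → (d : ℝ) ≤ x ^ (1 / 3 : ℝ) →
      A.congrSum d x ≤ K₆ * (σ 0 d : ℝ) ^ 8 / d * A.size x) :
    ∑ n ∈ Ioc 0 ⌊x⌋₊, A.a n * ((n.divisors.card : ℝ)) ^ 4 ≤
      2 ^ 12 * max K₆ 0 * Real.exp (2 ^ 22) * A.size x * Real.log x ^ (2 ^ 20 : ℝ) := by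
  classical
  have hx1 : (1 : ℝ) < x := by linarith
  have hx0 : (0 : ℝ) ≤ x := by linarith
  have hlogx : 0 < Real.log x := Real.log_pos hx1
  have hA0 : 0 ≤ A.size x := by rw [h.size_eq]; exact A.congrSum_nonneg 1 x
  set N : ℕ := ⌊x ^ (1 / 3 : ℝ)⌋₊ with hN
  have hx13 : (2 : ℝ) ≤ x ^ (1 / 3 : ℝ) := by
    have h8 : (8 : ℝ) ^ (1 / 3 : ℝ) = 2 := by
      rw [show (8 : ℝ) = 2 ^ 3 by norm_num, ← Real.rpow_natCast, ← Real.rpow_mul (by norm_num)]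
      norm_num
    rw [← h8]
    exact Real.rpow_le_rpow (by norm_num) hx (by norm_num)
  have hN2 : 2 ≤ N := Nat.le_floor (by exact_mod_cast hx13)
  set S₃ := (Icc 1 N).filter Squarefree with hS₃
  -- Step 2: `∑_n a_n τ(n)^4 ≤ ∑_{d ∈ S₃} (2τ(d))^{12} A_d(x)`
  have step2 : ∑ n ∈ Ioc 0 ⌊x⌋₊, A.a n * ((n.divisors.card : ℝ)) ^ 4 ≤
      ∑ d ∈ S₃, (2 * (d.divisors.card : ℝ)) ^ 12 * A.congrSum d x := by
    rw [A.sum_mul_congrSum_eq]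
    refine Finset.sum_le_sum fun n hn => ?_
    obtain ⟨hn0, hnx⟩ := Finset.mem_Ioc.mp hn
    by_cases hsq : Squarefree n
    · refine mul_le_mul_of_nonneg_left ((card_divisors_pow_four_le_sum hsq).trans ?_) (A.a_nonneg n)
      refine Finset.sum_le_sum_of_subset_of_nonneg (fun d hd => ?_) fun d _ _ => by positivity
      obtain ⟨hd1, hd3⟩ := Finset.mem_filter.mp hd
      have hdn : d ∣ n := Nat.dvd_of_mem_divisors hd1
      have hd0 : 0 < d := Nat.pos_of_mem_divisors hd1
      refine Finset.mem_filter.mpr ⟨Finset.mem_filter.mpr ⟨Finset.mem_Icc.mpr ⟨hd0, ?_⟩,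
        hsq.squarefree_of_dvd hdn⟩, hdn⟩
      -- `d³ ≤ n ≤ x` gives `d ≤ x^{1/3}`
      refine Nat.le_floor ?_
      have hd3' : ((d : ℝ)) ^ 3 ≤ x := by
        have : ((d ^ 3 : ℕ) : ℝ) ≤ (n : ℝ) := by exact_mod_cast hd3
        push_cast at this
        exact this.trans ((Nat.cast_le.mpr hnx).trans (Nat.floor_le hx0))
      have hroot : (((d : ℝ)) ^ 3) ^ (1 / 3 : ℝ) = d := by
        rw [← Real.rpow_natCast, ← Real.rpow_mul (Nat.cast_nonneg _)]
        norm_num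
      calc (d : ℝ) = (((d : ℝ)) ^ 3) ^ (1 / 3 : ℝ) := hroot.symm
        _ ≤ x ^ (1 / 3 : ℝ) := Real.rpow_le_rpow (by positivity) hd3' (by norm_num)
    · rw [h.a_eq_zero hsq, zero_mul, zero_mul]
  -- Step 3: (1.6) on `S₃`
  have step3 : ∑ d ∈ S₃, (2 * (d.divisors.card : ℝ)) ^ 12 * A.congrSum d x ≤
      2 ^ 12 * max K₆ 0 * A.size x * ∑ d ∈ S₃, ((d.divisors.card : ℝ) ^ 20) / d := by
    rw [Finset.mul_sum]
    refine Finset.sum_le_sum fun d hd => ?_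
    obtain ⟨hd1, -⟩ := Finset.mem_filter.mp hd
    obtain ⟨hd1', hdN⟩ := Finset.mem_Icc.mp hd1
    have hdx : (d : ℝ) ≤ x ^ (1 / 3 : ℝ) :=
      (Nat.cast_le.mpr hdN).trans (Nat.floor_le (by positivity))
    have hd0 : (0 : ℝ) < d := by exact_mod_cast hd1'
    have h6 := h16 d hd1' hdx
    rw [ArithmeticFunction.sigma_zero_apply] at h6
    have h6' : A.congrSum d x ≤ max K₆ 0 * ((d.divisors.card : ℝ)) ^ 8 / d * A.size x := by
      refine h6.trans ?_
      gcongr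
      exact le_max_left _ _
    calc (2 * (d.divisors.card : ℝ)) ^ 12 * A.congrSum d x
        ≤ (2 * (d.divisors.card : ℝ)) ^ 12 * (max K₆ 0 * ((d.divisors.card : ℝ)) ^ 8 / d * A.size x) :=
          mul_le_mul_of_nonneg_left h6' (by positivity)
      _ = 2 ^ 12 * max K₆ 0 * A.size x * (((d.divisors.card : ℝ)) ^ 20 / d) := by
          rw [mul_pow]; ring
  -- Step 4: `V(N) ≤ e^{2^22} (log x)^{2^20}`
  have step4 : ∑ d ∈ S₃, ((d.divisors.card : ℝ) ^ 20) / d ≤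
      Real.exp (2 ^ 22) * Real.log x ^ (2 ^ 20 : ℝ) := by
    refine (sum_squarefree_card_divisors_pow_div_le N hN2).trans ?_
    have hN0 : (0 : ℝ) < N := by exact_mod_cast (by omega : 0 < N)
    have hNx : (N : ℝ) ≤ x := by
      refine (Nat.floor_le (by positivity)).trans ?_
      calc x ^ (1 / 3 : ℝ) ≤ x ^ (1 : ℝ) := Real.rpow_le_rpow_of_exponent_le hx1.le (by norm_num)
        _ = x := Real.rpow_one x
    have hlogN : 0 < Real.log N := Real.log_pos (by exact_mod_cast hN2)
    have hll : Real.log (Real.log N) ≤ Real.log (Real.log x) :=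
      Real.log_le_log hlogN (Real.log_le_log hN0 hNx)
    rw [Real.rpow_def_of_pos hlogx, ← Real.exp_add]
    refine Real.exp_le_exp.mpr ?_
    nlinarith
  calc ∑ n ∈ Ioc 0 ⌊x⌋₊, A.a n * ((n.divisors.card : ℝ)) ^ 4
      ≤ 2 ^ 12 * max K₆ 0 * A.size x * ∑ d ∈ S₃, ((d.divisors.card : ℝ) ^ 20) / d :=
        step2.trans step3
    _ ≤ 2 ^ 12 * max K₆ 0 * A.size x * (Real.exp (2 ^ 22) * Real.log x ^ (2 ^ 20 : ℝ)) :=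
        mul_le_mul_of_nonneg_left step4 (by positivity)
    _ = 2 ^ 12 * max K₆ 0 * Real.exp (2 ^ 22) * A.size x * Real.log x ^ (2 ^ 20 : ℝ) := by ring

/-- **(2.1), main-term side.** For any finite set `T` of positive integers,
`∑_{d ∈ T} 9^{ω(d)} A_d(x) ≤ ∑_{n ≤ x} a_n τ(n)^4 ≤ 2^{12} K₆ e^{2^{22}} A(x) (log x)^{2^{20}}`
(FI p. 1047: `∑ τ₅(d)^{4/3} A_d(x) ≤ ∑ τ₁₁(n) a_n ≤ ∑ τ(n)^4 a_n ≤ ∑_{d ≤ x^{1/3}} (2τ(d))^{12} A_d(x)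
≪ A(x) V(x)`, by Lemma 1 and (1.6)), given (1.6) at `x ≥ 8` with constant `K₆`.
[cite: FriedlanderIwaniecASP1998, §2 (2.1)] -/
theorem FIAsymptoticSieveHypotheses.sum_nine_pow_mul_congrSum_le
    (h : A.FIAsymptoticSieveHypotheses D δ Δ) {K₆ x : ℝ} (hx : 8 ≤ x)
    (h16 : ∀ d : ℕ, 1 ≤ d → (d : ℝ) ≤ x ^ (1 / 3 : ℝ) →
      A.congrSum d x ≤ K₆ * (σ 0 d : ℝ) ^ 8 / d * A.size x)
    (T : Finset ℕ) :
    ∑ d ∈ T, (9 : ℝ) ^ d.primeFactors.card * A.congrSum d x ≤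
      2 ^ 12 * max K₆ 0 * Real.exp (2 ^ 22) * A.size x * Real.log x ^ (2 ^ 20 : ℝ) := by
  classical
  -- Step 1: `∑_{d ∈ T} 9^{ω(d)} A_d(x) ≤ ∑_n a_n τ(n)^4`
  have step1 : ∑ d ∈ T, (9 : ℝ) ^ d.primeFactors.card * A.congrSum d x ≤
      ∑ n ∈ Ioc 0 ⌊x⌋₊, A.a n * ((n.divisors.card : ℝ)) ^ 4 := by
    rw [A.sum_mul_congrSum_eq]
    refine Finset.sum_le_sum fun n hn => ?_
    have hn0 : n ≠ 0 := (Finset.mem_Ioc.mp hn).1.ne'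
    by_cases hsq : Squarefree n
    · refine mul_le_mul_of_nonneg_left ?_ (A.a_nonneg n)
      refine le_trans ?_ (ten_pow_le_card_divisors_pow_four hsq)
      rw [← sum_divisors_nine_pow_of_squarefree hsq]
      refine Finset.sum_le_sum_of_subset_of_nonneg (fun d hd => ?_) fun d _ _ => by positivity
      exact Nat.mem_divisors.mpr ⟨(Finset.mem_filter.mp hd).2, hn0⟩
    · rw [h.a_eq_zero hsq, zero_mul, zero_mul]
  exact step1.trans (h.sum_a_mul_card_divisors_pow_four_le hx h16)

/-- **(2.2).** `∑_{d ≤ x, d squarefree} 9^{ω(d)} g(d) ≤ ∏_{p ≤ x} (1 + 9g(p)) ≤ e^{9C} (log x)^9`,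
`C = |c| + |K₉|/(log 2)^{10}`, by multiplicativity and (1.9) (FI p. 1047:
"`∑ τ₅(d)^{4/3} g(d) ≤ ∏_{p ≤ x} (1 + 11 g(p)) ≪ (log x)^{11}`"). [cite: FriedlanderIwaniecASP1998, §2 (2.2)] -/
theorem FIAsymptoticSieveHypotheses.sum_nine_pow_mul_density_le
    (h : A.FIAsymptoticSieveHypotheses D δ Δ) {c K₉ x : ℝ} (hx : 2 ≤ x)
    (h19 : ∀ y : ℝ, 2 ≤ y →
      |(∑ p ∈ Nat.primesLE ⌊y⌋₊, A.density p) - (Real.log (Real.log y) + c)| ≤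
        K₉ / Real.log y ^ 10) :
    ∑ d ∈ (Icc 1 ⌊x⌋₊).filter Squarefree, (9 : ℝ) ^ d.primeFactors.card * A.density d ≤
      Real.exp (9 * (|c| + |K₉| / Real.log 2 ^ 10)) * Real.log x ^ (9 : ℝ) := by
  have hx1 : (1 : ℝ) < x := by linarith
  have hlogx : 0 < Real.log x := Real.log_pos hx1
  have hl2 : 0 < Real.log 2 := Real.log_pos one_lt_two
  have hl2x : Real.log 2 ≤ Real.log x := Real.log_le_log two_pos hx
  have hg0 : ∀ p : ℕ, p.Prime → 0 ≤ A.density p := fun p hp => (h.density_prime hp).1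
  -- rewrite the summand as a product over prime factors
  have h1 : ∀ d ∈ (Icc 1 ⌊x⌋₊).filter Squarefree,
      (9 : ℝ) ^ d.primeFactors.card * A.density d = ∏ p ∈ d.primeFactors, 9 * A.density p := by
    intro d hd
    have hsq := (Finset.mem_filter.mp hd).2
    rw [Finset.prod_mul_distrib, Finset.prod_const, A.density_mult.prod_primeFactors hsq]
  rw [Finset.sum_congr rfl h1]
  refine (sum_squarefree_prod_primeFactors_le (fun p hp => by linarith [hg0 p hp]) _).trans ?_
  refine (prod_one_add_le_exp_sum _ fun p hp =>
    by linarith [hg0 p (Nat.prime_of_mem_primesLE hp)]).trans ?_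
  rw [← Finset.mul_sum, Real.rpow_def_of_pos hlogx, ← Real.exp_add]
  refine Real.exp_le_exp.mpr ?_
  have h9 := h19 x hx
  have h9' := (abs_le.mp h9).2
  have hK9 : K₉ / Real.log x ^ 10 ≤ |K₉| / Real.log 2 ^ 10 := by
    calc K₉ / Real.log x ^ 10 ≤ |K₉| / Real.log x ^ 10 :=
          div_le_div_of_nonneg_right (le_abs_self _) (by positivity)
      _ ≤ |K₉| / Real.log 2 ^ 10 := by
          refine div_le_div_of_nonneg_left (abs_nonneg _) (by positivity) ?_
          gcongr
  nlinarith [le_abs_self c]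

/-- Numerical inequality `5^{4/3} ≤ 9` (as `625^{1/3} ≤ 729^{1/3}`). [folklore] -/
theorem five_rpow_four_thirds_le_nine : (5 : ℝ) ^ (4 / 3 : ℝ) ≤ 9 := by
  have h5 : (5 : ℝ) ^ (4 / 3 : ℝ) = (625 : ℝ) ^ (1 / 3 : ℝ) := by
    rw [show (625 : ℝ) = 5 ^ (4 : ℝ) by norm_num, ← Real.rpow_mul (by norm_num)]
    norm_num
  have h9 : (9 : ℝ) = (729 : ℝ) ^ (1 / 3 : ℝ) := by
    rw [show (729 : ℝ) = 9 ^ (3 : ℝ) by norm_num, ← Real.rpow_mul (by norm_num)]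
    norm_num
  rw [h5, h9]
  exact Real.rpow_le_rpow (by norm_num) (by norm_num) (by norm_num)

/-- **Hölder step of the reduction (R) ⟹ (R′)** (FI p. 1047: "(R′) follows from (R) and (2.3) by
Hölder's inequality"): for nonnegative `r` on a set `S` of squarefree integers,
`∑_S τ₅(d) r(d) ≤ (∑_S r(d))^{1/4} (∑_S 9^{ω(d)} r(d))^{3/4}` (exponents `4`, `4/3`;
`τ₅(d)^{4/3} = 5^{4ω(d)/3} ≤ 9^{ω(d)}`). [cite: FriedlanderIwaniecASP1998, §2 (R′)] -/
theorem sum_divisorCountK_five_mul_le_holder (S : Finset ℕ) (hS : ∀ d ∈ S, Squarefree d)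
    {r : ℕ → ℝ} (hr : ∀ d ∈ S, 0 ≤ r d) :
    ∑ d ∈ S, (divisorCountK 5 d : ℝ) * r d ≤
      (∑ d ∈ S, r d) ^ (1 / 4 : ℝ) * (∑ d ∈ S, (9 : ℝ) ^ d.primeFactors.card * r d) ^ (3 / 4 : ℝ) := by
  have hpq : (4 : ℝ).HolderConjugate (4 / 3) := Real.holderConjugate_iff.mpr ⟨by norm_num, by norm_num⟩
  have hH := Real.inner_le_Lp_mul_Lq_of_nonneg S hpq
    (f := fun d => r d ^ (1 / 4 : ℝ)) (g := fun d => (5 : ℝ) ^ d.primeFactors.card * r d ^ (3 / 4 : ℝ))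
    (fun d hd => Real.rpow_nonneg (hr d hd) _)
    (fun d hd => mul_nonneg (by positivity) (Real.rpow_nonneg (hr d hd) _))
  -- identify the left-hand side
  have hL : ∑ d ∈ S, (divisorCountK 5 d : ℝ) * r d =
      ∑ d ∈ S, r d ^ (1 / 4 : ℝ) * ((5 : ℝ) ^ d.primeFactors.card * r d ^ (3 / 4 : ℝ)) := by
    refine Finset.sum_congr rfl fun d hd => ?_
    rw [divisorCountK_apply_of_squarefree 5 (hS d hd), ← card_primeFactors_eq_cardDistinctFactors]
    push_cast
    have : r d ^ (1 / 4 : ℝ) * r d ^ (3 / 4 : ℝ) = r d := by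
      rw [← Real.rpow_add' (hr d hd) (by norm_num)]
      norm_num
    calc (5 : ℝ) ^ d.primeFactors.card * r d
        = (5 : ℝ) ^ d.primeFactors.card * (r d ^ (1 / 4 : ℝ) * r d ^ (3 / 4 : ℝ)) := by rw [this]
      _ = _ := by ring
  rw [hL]
  refine hH.trans ?_
  -- first factor: `(∑ (r^{1/4})^4)^{1/4} = (∑ r)^{1/4}`
  have h1 : ∑ d ∈ S, (r d ^ (1 / 4 : ℝ)) ^ (4 : ℝ) = ∑ d ∈ S, r d := by
    refine Finset.sum_congr rfl fun d hd => ?_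
    rw [← Real.rpow_mul (hr d hd)]
    norm_num
  -- second factor: `∑ (5^ω r^{3/4})^{4/3} ≤ ∑ 9^ω r`
  have h2 : ∑ d ∈ S, ((5 : ℝ) ^ d.primeFactors.card * r d ^ (3 / 4 : ℝ)) ^ (4 / 3 : ℝ) ≤
      ∑ d ∈ S, (9 : ℝ) ^ d.primeFactors.card * r d := by
    refine Finset.sum_le_sum fun d hd => ?_
    rw [Real.mul_rpow (by positivity) (Real.rpow_nonneg (hr d hd) _), ← Real.rpow_mul (hr d hd)]
    norm_num
    refine mul_le_mul_of_nonneg_right ?_ (hr d hd)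
    rw [← Real.rpow_natCast, ← Real.rpow_natCast (9 : ℝ), ← Real.rpow_mul (by norm_num),
      mul_comm, Real.rpow_mul (by norm_num)]
    exact Real.rpow_le_rpow (by positivity) five_rpow_four_thirds_le_nine (Nat.cast_nonneg _)
  rw [h1]
  norm_num
  refine mul_le_mul_of_nonneg_left ?_ (Real.rpow_nonneg (Finset.sum_nonneg hr) _)
  exact Real.rpow_le_rpow (Finset.sum_nonneg fun d hd => by
    exact Real.rpow_nonneg (mul_nonneg (by positivity) (Real.rpow_nonneg (hr d hd) _)) _) h2
    (by norm_num)

end SieveSequence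

/-- **Discharge of `fi_reduced_remainder_bound` ((R) ⟹ (R′), FI §2 pp. 1046–1047).** For large `x`
and `t ≤ x`, with `S = {d ≤ D(x) squarefree}`, `L = log x ≥ 1`, `A = A(x)`:
`R₀ = ∑_S |r_d(t)| ≤ A L^{-2^{22}}` by (R); `R₁ = ∑_S 9^{ω(d)} |r_d(t)| ≤ C₁ A L^{2^{20}}` by
`|r_d(t)| ≤ A_d(x) + g(d)A(x)`, (2.1) (`sum_nine_pow_mul_congrSum_le`: Lemma 1, (1.6), Mertens) and
(2.2) (`sum_nine_pow_mul_density_le`: (1.9)); Hölder with exponents `(4, 4/3)` and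
`τ₅^{4/3} ≤ 9^ω` gives `∑_S τ₅(d)|r_d(t)| ≤ R₀^{1/4} R₁^{3/4} ≤ C₁^{3/4} A L^{-2^{18}} ≤ (C₁ + 1) A L^{-3}`.
[cite: FriedlanderIwaniecASP1998, §2 (R′)] -/
theorem fi_reduced_remainder_bound_holds : fi_reduced_remainder_bound := by
  intro A D δ Δ h
  obtain ⟨K₆, h16⟩ := h.2.2.1
  obtain ⟨c, K₉, h19⟩ := h.2.2.2.2.1
  have hR1 := h.2.2.2.2.2.2.1
  have hR := h.2.2.2.2.2.2.2.1
  set Cg : ℝ := 9 * (|c| + |K₉| / Real.log 2 ^ 10) with hCg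
  set C₁ : ℝ := 2 ^ 12 * max K₆ 0 * Real.exp (2 ^ 22) + Real.exp Cg with hC₁
  have hC₁0 : 0 ≤ C₁ := by positivity
  refine ⟨C₁ + 1, ?_⟩
  filter_upwards [h16, hR1, hR, eventually_ge_atTop (8 : ℝ)] with x h16x hR1x hRx hx8 t htx
  -- basics at `x`
  have hx2 : (2 : ℝ) ≤ x := by linarith
  have hx1 : (1 : ℝ) < x := by linarith
  have hx0 : (0 : ℝ) ≤ x := by linarith
  set L : ℝ := Real.log x with hLdef
  have hL1 : 1 ≤ L := by
    rw [hLdef, ← Real.log_exp 1]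
    refine Real.log_le_log (Real.exp_pos 1) ?_
    have := Real.exp_one_lt_d9
    linarith
  have hL0 : 0 < L := by linarith
  have hA0 : 0 ≤ A.size x := by rw [h.size_eq]; exact A.congrSum_nonneg 1 x
  set S := (Icc 1 ⌊D x⌋₊).filter Squarefree with hSdef
  have hSsq : ∀ d ∈ S, Squarefree d := fun d hd => (Finset.mem_filter.mp hd).2
  set r : ℕ → ℝ := fun d => |A.remainder d t| with hrdef
  have hr0 : ∀ d ∈ S, 0 ≤ r d := fun d _ => abs_nonneg _
  -- `R₀`
  have hR0 : ∑ d ∈ S, r d ≤ A.size x * L ^ (-(2 ^ 22 : ℝ)) := by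
    have h0 := hRx t htx
    rw [Real.rpow_neg hL0.le, ← div_eq_mul_inv]
    convert h0 using 2
    rw [SieveSequence.fiLogSaving, ← Real.rpow_natCast]
    norm_num
  -- `R₁`
  have hR1' : ∑ d ∈ S, (9 : ℝ) ^ d.primeFactors.card * r d ≤ C₁ * A.size x * L ^ (2 ^ 20 : ℝ) := by
    have hstep : ∑ d ∈ S, (9 : ℝ) ^ d.primeFactors.card * r d ≤
        ∑ d ∈ S, (9 : ℝ) ^ d.primeFactors.card * A.congrSum d x +
          A.size x * ∑ d ∈ S, (9 : ℝ) ^ d.primeFactors.card * A.density d := by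
      rw [Finset.mul_sum, ← Finset.sum_add_distrib]
      refine Finset.sum_le_sum fun d hd => ?_
      have hsq := hSsq d hd
      have hg := h.density_nonneg_of_squarefree hsq
      have := h.abs_remainder_le hg htx (d := d)
      calc (9 : ℝ) ^ d.primeFactors.card * r d
          ≤ (9 : ℝ) ^ d.primeFactors.card * (A.congrSum d x + A.density d * A.size x) :=
            mul_le_mul_of_nonneg_left this (by positivity)
        _ = _ := by ring
    have hB1 := h.sum_nine_pow_mul_congrSum_le hx8 h16x S
    have hB2 : ∑ d ∈ S, (9 : ℝ) ^ d.primeFactors.card * A.density d ≤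
        Real.exp Cg * L ^ (9 : ℝ) := by
      refine le_trans ?_ (h.sum_nine_pow_mul_density_le hx2 h19)
      refine Finset.sum_le_sum_of_subset_of_nonneg ?_ fun d hd _ =>
        mul_nonneg (by positivity) (h.density_nonneg_of_squarefree (Finset.mem_filter.mp hd).2)
      intro d hd
      obtain ⟨hd1, hd2⟩ := Finset.mem_filter.mp hd
      obtain ⟨hd1a, hd1b⟩ := Finset.mem_Icc.mp hd1
      refine Finset.mem_filter.mpr ⟨Finset.mem_Icc.mpr ⟨hd1a, hd1b.trans ?_⟩, hd2⟩
      exact Nat.floor_le_floor hR1x.2.1.le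
    have hL9 : L ^ (9 : ℝ) ≤ L ^ (2 ^ 20 : ℝ) := Real.rpow_le_rpow_of_exponent_le hL1 (by norm_num)
    have hLp : 0 ≤ L ^ (2 ^ 20 : ℝ) := Real.rpow_nonneg hL0.le _
    calc ∑ d ∈ S, (9 : ℝ) ^ d.primeFactors.card * r d
        ≤ 2 ^ 12 * max K₆ 0 * Real.exp (2 ^ 22) * A.size x * L ^ (2 ^ 20 : ℝ) +
            A.size x * (Real.exp Cg * L ^ (9 : ℝ)) :=
          hstep.trans (add_le_add hB1 (mul_le_mul_of_nonneg_left hB2 hA0))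
      _ ≤ 2 ^ 12 * max K₆ 0 * Real.exp (2 ^ 22) * A.size x * L ^ (2 ^ 20 : ℝ) +
            A.size x * (Real.exp Cg * L ^ (2 ^ 20 : ℝ)) := by gcongr
      _ = C₁ * A.size x * L ^ (2 ^ 20 : ℝ) := by rw [hC₁]; ring
  -- Hölder
  have hH := SieveSequence.sum_divisorCountK_five_mul_le_holder S hSsq hr0
  have hR0' : (∑ d ∈ S, r d) ^ (1 / 4 : ℝ) ≤ (A.size x * L ^ (-(2 ^ 22 : ℝ))) ^ (1 / 4 : ℝ) :=
    Real.rpow_le_rpow (Finset.sum_nonneg hr0) hR0 (by norm_num)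
  have hR1'' : (∑ d ∈ S, (9 : ℝ) ^ d.primeFactors.card * r d) ^ (3 / 4 : ℝ) ≤
      (C₁ * A.size x * L ^ (2 ^ 20 : ℝ)) ^ (3 / 4 : ℝ) :=
    Real.rpow_le_rpow (Finset.sum_nonneg fun d hd => mul_nonneg (by positivity) (hr0 d hd)) hR1'
      (by norm_num)
  -- the algebra of the exponents
  have hLneg : 0 ≤ L ^ (-(2 ^ 22 : ℝ)) := Real.rpow_nonneg hL0.le _
  have hprod : (A.size x * L ^ (-(2 ^ 22 : ℝ))) ^ (1 / 4 : ℝ) *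
      (C₁ * A.size x * L ^ (2 ^ 20 : ℝ)) ^ (3 / 4 : ℝ) =
        C₁ ^ (3 / 4 : ℝ) * A.size x * L ^ (-(2 ^ 18 : ℝ)) := by
    rw [Real.mul_rpow hA0 hLneg, Real.mul_rpow (mul_nonneg hC₁0 hA0) (Real.rpow_nonneg hL0.le _),
      Real.mul_rpow hC₁0 hA0, ← Real.rpow_mul hL0.le, ← Real.rpow_mul hL0.le]
    have hA : A.size x ^ (1 / 4 : ℝ) * A.size x ^ (3 / 4 : ℝ) = A.size x := by
      rw [← Real.rpow_add' hA0 (by norm_num)]; norm_num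
    have hLL : L ^ (-(2 ^ 22 : ℝ) * (1 / 4)) * L ^ ((2 ^ 20 : ℝ) * (3 / 4)) = L ^ (-(2 ^ 18 : ℝ)) := by
      rw [← Real.rpow_add hL0]; norm_num
    calc A.size x ^ (1 / 4 : ℝ) * L ^ (-(2 ^ 22 : ℝ) * (1 / 4)) *
          (C₁ ^ (3 / 4 : ℝ) * A.size x ^ (3 / 4 : ℝ) * L ^ ((2 ^ 20 : ℝ) * (3 / 4)))
        = C₁ ^ (3 / 4 : ℝ) * (A.size x ^ (1 / 4 : ℝ) * A.size x ^ (3 / 4 : ℝ)) *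
            (L ^ (-(2 ^ 22 : ℝ) * (1 / 4)) * L ^ ((2 ^ 20 : ℝ) * (3 / 4))) := by ring
      _ = C₁ ^ (3 / 4 : ℝ) * A.size x * L ^ (-(2 ^ 18 : ℝ)) := by rw [hA, hLL]
  have hC34 : C₁ ^ (3 / 4 : ℝ) ≤ C₁ + 1 := by
    rcases le_or_gt 1 C₁ with h1 | h1
    · calc C₁ ^ (3 / 4 : ℝ) ≤ C₁ ^ (1 : ℝ) := Real.rpow_le_rpow_of_exponent_le h1 (by norm_num)
        _ = C₁ := Real.rpow_one _
        _ ≤ C₁ + 1 := by linarith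
    · have : C₁ ^ (3 / 4 : ℝ) ≤ 1 := Real.rpow_le_one hC₁0 h1.le (by norm_num)
      linarith
  have hL18 : L ^ (-(2 ^ 18 : ℝ)) ≤ (L ^ 3)⁻¹ := by
    calc L ^ (-(2 ^ 18 : ℝ)) ≤ L ^ (-(3 : ℝ)) := Real.rpow_le_rpow_of_exponent_le hL1 (by norm_num)
      _ = (L ^ 3)⁻¹ := by rw [Real.rpow_neg hL0.le, ← Real.rpow_natCast]; norm_num
  calc ∑ d ∈ S, (divisorCountK 5 d : ℝ) * |A.remainder d t|
      = ∑ d ∈ S, (divisorCountK 5 d : ℝ) * r d := rfl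
    _ ≤ (∑ d ∈ S, r d) ^ (1 / 4 : ℝ) *
          (∑ d ∈ S, (9 : ℝ) ^ d.primeFactors.card * r d) ^ (3 / 4 : ℝ) := hH
    _ ≤ (A.size x * L ^ (-(2 ^ 22 : ℝ))) ^ (1 / 4 : ℝ) *
          (C₁ * A.size x * L ^ (2 ^ 20 : ℝ)) ^ (3 / 4 : ℝ) :=
        mul_le_mul hR0' hR1'' (Real.rpow_nonneg (Finset.sum_nonneg fun d hd =>
          mul_nonneg (by positivity) (hr0 d hd)) _) (Real.rpow_nonneg (mul_nonneg hA0 hLneg) _)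
    _ = C₁ ^ (3 / 4 : ℝ) * A.size x * L ^ (-(2 ^ 18 : ℝ)) := hprod
    _ ≤ (C₁ + 1) * A.size x * (L ^ 3)⁻¹ :=
        mul_le_mul (mul_le_mul_of_nonneg_right hC34 hA0) hL18 (Real.rpow_nonneg hL0.le _)
          (by positivity)
    _ = (C₁ + 1) * A.size x / Real.log x ^ 3 := by rw [div_eq_mul_inv]

/-! ### The reduction (B) ⟹ (B′) -/

/-- The numerical tail of the Hölder step: if `R₀ ≤ A L^{-2^{22}}` and `R₁ ≤ C₁ A L^{2^{20}}` with
`L ≥ 1`, `A, C₁, R₀, R₁ ≥ 0`, then `R₀^{1/4} R₁^{3/4} ≤ (C₁ + 1) A / L³`. [folklore] -/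
theorem holder_tail_le {R₀ R₁ Asz L C₁ : ℝ} (hA0 : 0 ≤ Asz) (hL1 : 1 ≤ L) (hC₁0 : 0 ≤ C₁)
    (hr0 : 0 ≤ R₀) (hr1 : 0 ≤ R₁) (hR0 : R₀ ≤ Asz * L ^ (-(2 ^ 22 : ℝ)))
    (hR1 : R₁ ≤ C₁ * Asz * L ^ (2 ^ 20 : ℝ)) :
    R₀ ^ (1 / 4 : ℝ) * R₁ ^ (3 / 4 : ℝ) ≤ (C₁ + 1) * Asz / L ^ 3 := by
  have hL0 : 0 < L := by linarith
  have hLneg : 0 ≤ L ^ (-(2 ^ 22 : ℝ)) := Real.rpow_nonneg hL0.le _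
  have hR0' : R₀ ^ (1 / 4 : ℝ) ≤ (Asz * L ^ (-(2 ^ 22 : ℝ))) ^ (1 / 4 : ℝ) :=
    Real.rpow_le_rpow hr0 hR0 (by norm_num)
  have hR1' : R₁ ^ (3 / 4 : ℝ) ≤ (C₁ * Asz * L ^ (2 ^ 20 : ℝ)) ^ (3 / 4 : ℝ) :=
    Real.rpow_le_rpow hr1 hR1 (by norm_num)
  have hprod : (Asz * L ^ (-(2 ^ 22 : ℝ))) ^ (1 / 4 : ℝ) *
      (C₁ * Asz * L ^ (2 ^ 20 : ℝ)) ^ (3 / 4 : ℝ) = C₁ ^ (3 / 4 : ℝ) * Asz * L ^ (-(2 ^ 18 : ℝ)) := by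
    rw [Real.mul_rpow hA0 hLneg, Real.mul_rpow (mul_nonneg hC₁0 hA0) (Real.rpow_nonneg hL0.le _),
      Real.mul_rpow hC₁0 hA0, ← Real.rpow_mul hL0.le, ← Real.rpow_mul hL0.le]
    have hA : Asz ^ (1 / 4 : ℝ) * Asz ^ (3 / 4 : ℝ) = Asz := by
      rw [← Real.rpow_add' hA0 (by norm_num)]; norm_num
    have hLL : L ^ (-(2 ^ 22 : ℝ) * (1 / 4)) * L ^ ((2 ^ 20 : ℝ) * (3 / 4)) = L ^ (-(2 ^ 18 : ℝ)) := by
      rw [← Real.rpow_add hL0]; norm_num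
    calc Asz ^ (1 / 4 : ℝ) * L ^ (-(2 ^ 22 : ℝ) * (1 / 4)) *
          (C₁ ^ (3 / 4 : ℝ) * Asz ^ (3 / 4 : ℝ) * L ^ ((2 ^ 20 : ℝ) * (3 / 4)))
        = C₁ ^ (3 / 4 : ℝ) * (Asz ^ (1 / 4 : ℝ) * Asz ^ (3 / 4 : ℝ)) *
            (L ^ (-(2 ^ 22 : ℝ) * (1 / 4)) * L ^ ((2 ^ 20 : ℝ) * (3 / 4))) := by ring
      _ = C₁ ^ (3 / 4 : ℝ) * Asz * L ^ (-(2 ^ 18 : ℝ)) := by rw [hA, hLL]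
  have hC34 : C₁ ^ (3 / 4 : ℝ) ≤ C₁ + 1 := by
    rcases le_or_gt 1 C₁ with h1 | h1
    · calc C₁ ^ (3 / 4 : ℝ) ≤ C₁ ^ (1 : ℝ) := Real.rpow_le_rpow_of_exponent_le h1 (by norm_num)
        _ = C₁ := Real.rpow_one _
        _ ≤ C₁ + 1 := by linarith
    · have : C₁ ^ (3 / 4 : ℝ) ≤ 1 := Real.rpow_le_one hC₁0 h1.le (by norm_num)
      linarith
  have hL18 : L ^ (-(2 ^ 18 : ℝ)) ≤ (L ^ 3)⁻¹ := by
    calc L ^ (-(2 ^ 18 : ℝ)) ≤ L ^ (-(3 : ℝ)) := Real.rpow_le_rpow_of_exponent_le hL1 (by norm_num)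
      _ = (L ^ 3)⁻¹ := by rw [Real.rpow_neg hL0.le, ← Real.rpow_natCast]; norm_num
  calc R₀ ^ (1 / 4 : ℝ) * R₁ ^ (3 / 4 : ℝ)
      ≤ (Asz * L ^ (-(2 ^ 22 : ℝ))) ^ (1 / 4 : ℝ) * (C₁ * Asz * L ^ (2 ^ 20 : ℝ)) ^ (3 / 4 : ℝ) :=
        mul_le_mul hR0' hR1' (Real.rpow_nonneg hr1 _) (Real.rpow_nonneg (mul_nonneg hA0 hLneg) _)
    _ = C₁ ^ (3 / 4 : ℝ) * Asz * L ^ (-(2 ^ 18 : ℝ)) := hprod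
    _ ≤ (C₁ + 1) * Asz * (L ^ 3)⁻¹ :=
        mul_le_mul (mul_le_mul_of_nonneg_right hC34 hA0) hL18 (Real.rpow_nonneg hL0.le _)
          (by positivity)
    _ = (C₁ + 1) * Asz / L ^ 3 := by rw [div_eq_mul_inv]

/-- Rearranging a double sum over `m` and `n ∈ F(m)` with `mn ≤ X` as a sum over `k = mn ≤ X` and
the factorisations of `k` (nonnegative terms). [folklore] -/
theorem sum_sum_le_sum_divisorsAntidiagonal {f : ℕ → ℕ → ℝ} (hf : ∀ m n, 0 ≤ f m n) (X : ℕ)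
    (M : Finset ℕ) (F : ℕ → Finset ℕ)
    (hMF : ∀ m ∈ M, ∀ n ∈ F m, 1 ≤ m ∧ 1 ≤ n ∧ m * n ≤ X) :
    ∑ m ∈ M, ∑ n ∈ F m, f m n ≤
      ∑ k ∈ Ioc 0 X, ∑ p ∈ k.divisorsAntidiagonal, f p.1 p.2 := by
  classical
  -- the right-hand side as a sum over the disjoint union of the antidiagonals
  have hdisj : Set.PairwiseDisjoint (↑(Ioc 0 X) : Set ℕ) Nat.divisorsAntidiagonal := by
    intro k _ k' _ hkk'
    refine Finset.disjoint_left.mpr fun p hp hp' => hkk' ?_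
    rw [Nat.mem_divisorsAntidiagonal] at hp hp'
    rw [← hp.1, ← hp'.1]
  rw [← Finset.sum_biUnion hdisj]
  -- the left-hand side as a sum over the sigma type, then over its image in `ℕ × ℕ`
  rw [← Finset.sum_sigma M F (fun p => f p.1 p.2)]
  have hinj : Set.InjOn (fun p : (Σ _ : ℕ, ℕ) => (p.1, p.2)) ↑(M.sigma F) := by
    rintro ⟨a, b⟩ _ ⟨c, d⟩ _ h
    simp only [Prod.mk.injEq] at h
    obtain ⟨rfl, rfl⟩ := h
    rfl
  have : ∑ p ∈ M.sigma F, f p.1 p.2 =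
      ∑ q ∈ (M.sigma F).image (fun p : (Σ _ : ℕ, ℕ) => (p.1, p.2)), f q.1 q.2 := by
    rw [Finset.sum_image hinj]
  rw [this]
  refine Finset.sum_le_sum_of_subset_of_nonneg (fun q hq => ?_) fun q _ _ => hf _ _
  obtain ⟨⟨m, n⟩, hp, rfl⟩ := Finset.mem_image.mp hq
  obtain ⟨hm, hn⟩ := Finset.mem_sigma.mp hp
  obtain ⟨hm1, hn1, hmn⟩ := hMF m hm n hn
  refine Finset.mem_biUnion.mpr ⟨m * n, Finset.mem_Ioc.mpr ⟨Nat.mul_pos hm1 hn1, hmn⟩, ?_⟩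
  exact Nat.mem_divisorsAntidiagonal.mpr ⟨rfl, (Nat.mul_pos hm1 hn1).ne'⟩

/-- For squarefree `k`, `∑_{mn = k} 9^{ω(m)} τ(n) = 11^{ω(k)} ≤ τ(k)^4` (`τ₉ * τ₂ = τ₁₁`).
[folklore] -/
theorem sum_divisorsAntidiagonal_nine_pow_mul_card_divisors_le {k : ℕ} (hk : Squarefree k) :
    ∑ p ∈ k.divisorsAntidiagonal, (9 : ℝ) ^ p.1.primeFactors.card * (p.2.divisors.card : ℝ) ≤
      ((k.divisors.card : ℝ)) ^ 4 := by
  have hmul : divisorCountK 9 * divisorCountK 2 = divisorCountK 11 := by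
    rw [divisorCountK, divisorCountK, divisorCountK, ← pow_add]
  have happ := congrArg (fun f : ArithmeticFunction ℕ => (f k : ℕ)) hmul
  simp only [ArithmeticFunction.mul_apply] at happ
  rw [divisorCountK_apply_of_squarefree 11 hk] at happ
  have hcast : ∑ p ∈ k.divisorsAntidiagonal, (9 : ℝ) ^ p.1.primeFactors.card * (p.2.divisors.card : ℝ) =
      ((11 ^ ω k : ℕ) : ℝ) := by
    rw [← happ]
    push_cast
    refine Finset.sum_congr rfl fun p hp => ?_
    have hp1 : p.1 ∣ k := Nat.fst_mem_divisors_of_mem_antidiagonal hp |> Nat.dvd_of_mem_divisors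
    rw [divisorCountK_apply_of_squarefree 9 (hk.squarefree_of_dvd hp1),
      ← card_primeFactors_eq_cardDistinctFactors]
    have h2 := congrArg (fun f : ArithmeticFunction ℕ => f p.2) divisorCountK_two
    simp only [ArithmeticFunction.sigma_zero_apply] at h2
    rw [h2]
    push_cast
    rfl
  rw [hcast, card_divisors_of_squarefree hk, ← card_primeFactors_eq_cardDistinctFactors]
  push_cast
  rw [← pow_mul, mul_comm, pow_mul]
  norm_num
  exact pow_le_pow_left₀ (by norm_num) (by norm_num) _

/-- **Discharge of `fi_reduced_bilinear_bound` ((B) ⟹ (B′), FI §2 p. 1047: "The derivation of (B′)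
from (B) is similar").** For large `x`, `N` in (B1), `C` in (B3), with `I_m` the inner sum of the
bilinear form, `M = {1 ≤ m ≤ x}`, `L = log x`, `A = A(x)`: `R₀ = ∑_M |I_m| ≤ A L^{-2^{22}}` by (B);
only squarefree `m` contribute ((1.16)); `R₁ = ∑_{M, m sqfree} 9^{ω(m)}|I_m| ≤
∑_m 9^{ω(m)} ∑_n τ(n) a_{mn} ≤ ∑_{k ≤ x} a_k ∑_{mn = k} 9^{ω(m)}τ(n) = ∑ a_k 11^{ω(k)} ≤ ∑ a_k τ(k)^4
≤ C₁ A L^{2^{20}}` (`|γ(n, C)| ≤ τ(n)`, (2.1)); Hölder as for (R′).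
[cite: FriedlanderIwaniecASP1998, §2 (B′)] -/
theorem fi_reduced_bilinear_bound_holds : fi_reduced_bilinear_bound := by
  intro A D δ Δ h
  obtain ⟨K₆, h16⟩ := h.2.2.1
  have hR1 := h.2.2.2.2.2.2.1
  have hB := h.2.2.2.2.2.2.2.2
  set C₁ : ℝ := 2 ^ 12 * max K₆ 0 * Real.exp (2 ^ 22) with hC₁
  have hC₁0 : 0 ≤ C₁ := by positivity
  refine ⟨C₁ + 1, ?_⟩
  filter_upwards [h16, hR1, hB, eventually_ge_atTop (8 : ℝ)] with x h16x hR1x hBx hx8 N hN1 hN2 C hC1 hC2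
  classical
  -- basics at `x`
  have hx1 : (1 : ℝ) < x := by linarith
  set L : ℝ := Real.log x with hLdef
  have hL1 : 1 ≤ L := by
    rw [hLdef, ← Real.log_exp 1]
    refine Real.log_le_log (Real.exp_pos 1) ?_
    have := Real.exp_one_lt_d9
    linarith
  have hL0 : 0 < L := by linarith
  have hA0 : 0 ≤ A.size x := by rw [h.size_eq]; exact A.congrSum_nonneg 1 x
  set M := Icc 1 ⌊x⌋₊ with hMdef
  set F : ℕ → Finset ℕ := fun m =>
    (Ioc ⌊N⌋₊ ⌊2 * N⌋₊).filter (fun n : ℕ => ((m * n : ℕ) : ℝ) ≤ x) with hFdef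
  set I : ℕ → ℝ := fun m =>
    ∑ n ∈ F m, (SieveSequence.fiGamma C n : ℝ) * (μ (m * n) : ℝ) * A.a (m * n) with hIdef
  -- (B)
  have hB0 : ∑ m ∈ M, |I m| ≤ A.size x * L ^ (-(2 ^ 22 : ℝ)) := by
    have h0 := hBx N hN1 hN2 C hC1 hC2
    rw [SieveSequence.fiBilinear] at h0
    rw [Real.rpow_neg hL0.le, ← div_eq_mul_inv]
    convert h0 using 2
    rw [SieveSequence.fiLogSaving, ← Real.rpow_natCast]
    norm_num
  -- only squarefree `m` contribute
  set Ms := M.filter Squarefree with hMsdef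
  have hI0 : ∀ m ∈ M, ¬Squarefree m → I m = 0 := by
    intro m _ hm
    refine Finset.sum_eq_zero fun n _ => ?_
    have : ¬Squarefree (m * n) := fun hmn => hm (Squarefree.of_mul_left hmn)
    rw [h.a_eq_zero this, mul_zero]
  have hsplit : ∑ m ∈ M, (divisorCountK 5 m : ℝ) * |I m| = ∑ m ∈ Ms, (divisorCountK 5 m : ℝ) * |I m| := by
    rw [hMsdef, Finset.sum_filter]
    refine Finset.sum_congr rfl fun m hm => ?_
    split_ifs with hsq
    · rfl
    · rw [hI0 m hm hsq, abs_zero, mul_zero]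
  have hMs : ∀ m ∈ Ms, Squarefree m := fun m hm => (Finset.mem_filter.mp hm).2
  -- `R₀`
  have hR0 : ∑ m ∈ Ms, |I m| ≤ A.size x * L ^ (-(2 ^ 22 : ℝ)) :=
    le_trans (Finset.sum_le_sum_of_subset_of_nonneg (Finset.filter_subset _ _)
      fun m _ _ => abs_nonneg _) hB0
  -- `R₁`
  have hR1' : ∑ m ∈ Ms, (9 : ℝ) ^ m.primeFactors.card * |I m| ≤ C₁ * A.size x * L ^ (2 ^ 20 : ℝ) := by
    -- `|I m| ≤ ∑_n τ(n) a_{mn}`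
    have hIle : ∀ m, |I m| ≤ ∑ n ∈ F m, ((n.divisors.card : ℝ)) * A.a (m * n) := by
      intro m
      refine (Finset.abs_sum_le_sum_abs _ _).trans (Finset.sum_le_sum fun n _ => ?_)
      rw [abs_mul, abs_mul, abs_of_nonneg (A.a_nonneg _)]
      have hγ : |(SieveSequence.fiGamma C n : ℝ)| ≤ (n.divisors.card : ℝ) := by
        have := SieveSequence.abs_fiGamma_le C n
        rw [ArithmeticFunction.sigma_zero_apply] at this
        exact_mod_cast this
      have hμ : |(μ (m * n) : ℝ)| ≤ 1 := by exact_mod_cast ArithmeticFunction.abs_moebius_le_one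
      calc |(SieveSequence.fiGamma C n : ℝ)| * |(μ (m * n) : ℝ)| * A.a (m * n)
          ≤ (n.divisors.card : ℝ) * 1 * A.a (m * n) := by gcongr; exact A.a_nonneg _
        _ = (n.divisors.card : ℝ) * A.a (m * n) := by ring
    calc ∑ m ∈ Ms, (9 : ℝ) ^ m.primeFactors.card * |I m|
        ≤ ∑ m ∈ M, (9 : ℝ) ^ m.primeFactors.card * |I m| :=
          Finset.sum_le_sum_of_subset_of_nonneg (Finset.filter_subset _ _)
            fun m _ _ => mul_nonneg (by positivity) (abs_nonneg _)
      _ ≤ ∑ m ∈ M, ∑ n ∈ F m, (9 : ℝ) ^ m.primeFactors.card * ((n.divisors.card : ℝ)) * A.a (m * n) := by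
          refine Finset.sum_le_sum fun m _ => ?_
          rw [show ∑ n ∈ F m, (9 : ℝ) ^ m.primeFactors.card * ((n.divisors.card : ℝ)) * A.a (m * n) =
            (9 : ℝ) ^ m.primeFactors.card * ∑ n ∈ F m, ((n.divisors.card : ℝ)) * A.a (m * n) by
            rw [Finset.mul_sum]; refine Finset.sum_congr rfl fun n _ => by ring]
          exact mul_le_mul_of_nonneg_left (hIle m) (by positivity)
      _ ≤ ∑ k ∈ Ioc 0 ⌊x⌋₊, ∑ p ∈ k.divisorsAntidiagonal,
            (9 : ℝ) ^ p.1.primeFactors.card * ((p.2.divisors.card : ℝ)) * A.a (p.1 * p.2) := by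
          refine sum_sum_le_sum_divisorsAntidiagonal (f := fun m n =>
            (9 : ℝ) ^ m.primeFactors.card * ((n.divisors.card : ℝ)) * A.a (m * n))
            (fun m n => mul_nonneg (by positivity) (A.a_nonneg _)) ⌊x⌋₊ M F fun m hm n hn => ?_
          obtain ⟨hm1, -⟩ := Finset.mem_Icc.mp hm
          obtain ⟨hn1, hn2⟩ := Finset.mem_filter.mp hn
          refine ⟨hm1, Nat.succ_le_of_lt (lt_of_le_of_lt (Nat.zero_le _) (Finset.mem_Ioc.mp hn1).1), ?_⟩
          exact Nat.le_floor hn2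
      _ = ∑ k ∈ Ioc 0 ⌊x⌋₊, A.a k * ∑ p ∈ k.divisorsAntidiagonal,
            (9 : ℝ) ^ p.1.primeFactors.card * ((p.2.divisors.card : ℝ)) := by
          refine Finset.sum_congr rfl fun k _ => ?_
          rw [Finset.mul_sum]
          refine Finset.sum_congr rfl fun p hp => ?_
          rw [(Nat.mem_divisorsAntidiagonal.mp hp).1]
          ring
      _ ≤ ∑ k ∈ Ioc 0 ⌊x⌋₊, A.a k * ((k.divisors.card : ℝ)) ^ 4 := by
          refine Finset.sum_le_sum fun k _ => ?_
          by_cases hsq : Squarefree k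
          · exact mul_le_mul_of_nonneg_left
              (sum_divisorsAntidiagonal_nine_pow_mul_card_divisors_le hsq) (A.a_nonneg k)
          · rw [h.a_eq_zero hsq, zero_mul, zero_mul]
      _ ≤ C₁ * A.size x * L ^ (2 ^ 20 : ℝ) := h.sum_a_mul_card_divisors_pow_four_le hx8 h16x
  -- Hölder and the numerical tail
  have hH := SieveSequence.sum_divisorCountK_five_mul_le_holder Ms hMs (r := fun m => |I m|)
    (fun m _ => abs_nonneg _)
  rw [hsplit]
  refine hH.trans ?_
  exact holder_tail_le hA0 hL1 hC₁0 (Finset.sum_nonneg fun m _ => abs_nonneg _)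
    (Finset.sum_nonneg fun m _ => mul_nonneg (by positivity) (abs_nonneg _)) hR0 hR1'

end Literature.NumberTheory.Sieve
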